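import Summits.Ventures.Crystal3D.Theorems.StickyWulffConstantGenericWallFloorExitCount
import Summits.Ventures.Crystal3D.Theorems.StickyWulffConstantGenericWallFloorExitLocation
import Summits.Ventures.Crystal3D.Theorems.StickyWulffConstantGenericWallFloorSealing
import Summits.Ventures.Crystal3D.Theorems.StickyWulffConstantGenericWallFloorPlateStop
import HarnessLib

/-!
# Exits live in the interior window `[−R₀ − 2, h + R₀ + 2]` off the rim (no clean-sliver hypothesis)

HONEST FRAMING. Part of the venture `Summits/Ventures/Crystal3D` (cell `crystal3d-full`), helper
`--supports` the crux `GenericWallFloor` (stmt-Ventures-19480) of `route-Ventures-StickyWulffConstant`,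
registered line `WallLedgerG`, open stub `stub_twoSlabAdhesion`.  Plumbing for the SEALED chain ledger
(`twoSlabAdhesion_chainLedger_sealed`, …ChainLedgerSealed): the lattice exits of the two grains counted by
`card_lattice_exits_ge_window` sit at heights `[−R₀ − 2, h + R₀ + 2]` (the payer window of 19481-p2's
interior ledger) unless they are RIM balls (lateral radius `> ρ − 3`).  Cell constants `R₀ = 10`.

* `height_add_slot`, `lateral_add_slot` — one slot step moves height and lateral radius by at most one;
* `lowExit_rim` / `highExit₂_rim` — an exit of the bottom grain below `−12`, resp. of the top grain above
  `h + 12`, off the rim would have its missing slot inside its own COMPLETE clamped sample;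
* `highExit_rim` / `lowExit₂_rim` — an exit of the bottom grain above `h + 12`, resp. of the top grain
  below `−12`, off the rim has its full-shell predecessor and the twelve slot neighbours SEALED onto the
  other grain's lattice (`sealing_below` / `sealing_above`), whence the two linear lattices coincide
  (`linear_eq_of_slots_on_affine`) — excluded for grains with different slot sets.

WHAT THIS IS NOT: no ledger; rung F-C1 not moved.
-/

noncomputable section

namespace Summit.Ventures.Crystal3D.Theorems

open Summit.Ventures.Crystal3D Finset
open Literature.MathematicalPhysics.StatisticalMechanics (fccStacking)
open scoped InnerProductSpace

/-- One slot step changes the height by at most one: `p₂ − 1 ≤ (p + A w)₂ ≤ p₂ + 1`. -/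
theorem height_add_slot (A : EuclideanSpace ℝ (Fin 3) ≃ₗᵢ[ℝ] EuclideanSpace ℝ (Fin 3))
    (p : EuclideanSpace ℝ (Fin 3)) {w : EuclideanSpace ℝ (Fin 3)} (hw : w ∈ fccSlots) :
    p 2 - 1 ≤ (p + A w) 2 ∧ (p + A w) 2 ≤ p 2 + 1 := by
  have h := abs_inner_slot_le_one A hw
  have h2 : (p + A w) 2 = p 2 + ⟪A w, EuclideanSpace.single (2 : Fin 3) (1 : ℝ)⟫_ℝ := by
    rw [PiLp.add_apply, apply_two_eq_inner_e₃ (A w)]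
  obtain ⟨hl, hu⟩ := abs_le.1 h
  constructor <;> linarith

/-- One slot step changes the lateral radius by at most one. -/
theorem lateral_add_slot (A : EuclideanSpace ℝ (Fin 3) ≃ₗᵢ[ℝ] EuclideanSpace ℝ (Fin 3))
    (p : EuclideanSpace ℝ (Fin 3)) {w : EuclideanSpace ℝ (Fin 3)} (hw : w ∈ fccSlots) {r : ℝ} (hr : 0 ≤ r)
    (hp : p 0 ^ 2 + p 1 ^ 2 ≤ r ^ 2) : (p + A w) 0 ^ 2 + (p + A w) 1 ^ 2 ≤ (r + 1) ^ 2 := by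
  have := lateral_sq_add_le p (A w) hr hp
  rwa [LinearIsometryEquiv.norm_map, norm_eq_one_of_mem_fccSlots hw] at this

/-- The predecessor `e − A u = e + A(−u)`: height and lateral control. -/
theorem pred_height_lateral (A : EuclideanSpace ℝ (Fin 3) ≃ₗᵢ[ℝ] EuclideanSpace ℝ (Fin 3))
    (e : EuclideanSpace ℝ (Fin 3)) {u : EuclideanSpace ℝ (Fin 3)} (hu : u ∈ fccSlots) {r : ℝ} (hr : 0 ≤ r)
    (he : e 0 ^ 2 + e 1 ^ 2 ≤ r ^ 2) :
    e 2 - 1 ≤ (e - A u) 2 ∧ (e - A u) 2 ≤ e 2 + 1 ∧ (e - A u) 0 ^ 2 + (e - A u) 1 ^ 2 ≤ (r + 1) ^ 2 := by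
  have h1 := height_add_slot A e (neg_mem_fccSlots hu)
  have h2 := lateral_add_slot A e (neg_mem_fccSlots hu) hr he
  rw [map_neg, ← sub_eq_add_neg] at h1 h2
  exact ⟨h1.1, h1.2, h2⟩

/-- **SEALING of a clamped slab off the rim, both boundary layers included.**  A ball of `X` at height
strictly inside `(a, b]`… precisely with `a ≤ q₂ ≤ b` and lateral radius `≤ ρ − 1` belongs to the complete
sample `P` of the window `[a, b]` (`b − a ≥ 2`). -/
theorem mem_sample_of_sealed (A : EuclideanSpace ℝ (Fin 3) ≃ₗᵢ[ℝ] EuclideanSpace ℝ (Fin 3))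
    (t : EuclideanSpace ℝ (Fin 3)) (a b ρ : ℝ) (hρ : 1 ≤ ρ) (hab : a + 2 ≤ b)
    {X P : Finset (EuclideanSpace ℝ (Fin 3))} (hX : ∀ p ∈ X, ∀ q ∈ X, p ≠ q → 1 ≤ dist p q) (hPX : P ⊆ X)
    (hP : ∀ p, p ∈ P ↔ (p ∈ (fun s => A s + t) '' fccStacking 1 (Real.sqrt (2 / 3)) ∧
      a ≤ p 2 ∧ p 2 ≤ b ∧ p 0 ^ 2 + p 1 ^ 2 ≤ ρ ^ 2))
    {q : EuclideanSpace ℝ (Fin 3)} (hqX : q ∈ X) (ha : a ≤ q 2) (hb : q 2 ≤ b)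
    (hr : q 0 ^ 2 + q 1 ^ 2 ≤ (ρ - 1) ^ 2) : q ∈ P := by
  by_contra hqP
  by_cases h1 : q 2 ≤ b - 1
  · exact sealing_below A t a b ρ hρ X P hX hPX hP q hqX hqP ha h1 hr
  · push Not at h1
    exact sealing_above A t a b ρ hρ X P hX hPX hP q hqX hqP (by linarith) hb hr

variable {X P₁ P₂ : Finset (EuclideanSpace ℝ (Fin 3))} {h ρ : ℝ}

/-- **Low exits of the bottom grain are rim balls.**  (`R₀ = 10`.)  A lattice exit of grain 1 along a
steep up-slot `u₁` at height `< −12` has lateral radius `> ρ − 3`: otherwise its missing slot would be a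
site of the complete bottom sample. -/
theorem lowExit_rim (A₁ : EuclideanSpace ℝ (Fin 3) ≃ₗᵢ[ℝ] EuclideanSpace ℝ (Fin 3)) (t₁ : EuclideanSpace ℝ (Fin 3))
    (hρ : 10 ≤ ρ) (hP₁X : P₁ ⊆ X)
    (hcell : ∀ p ∈ X, -(2 * 10) ≤ p 2 ∧ p 2 ≤ h + 2 * 10 ∧ p 0 ^ 2 + p 1 ^ 2 ≤ ρ ^ 2)
    (hP₁ : ∀ p, p ∈ P₁ ↔ (p ∈ (fun q => A₁ q + t₁) '' fccStacking 1 (Real.sqrt (2 / 3)) ∧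
      -(2 * 10) ≤ p 2 ∧ p 2 ≤ -10 ∧ p 0 ^ 2 + p 1 ^ 2 ≤ ρ ^ 2))
    {u₁ : EuclideanSpace ℝ (Fin 3)} (hu₁ : u₁ ∈ fccSlots)
    (hsteep₁ : Real.sqrt 2 / 2 ≤ ⟪A₁ u₁, EuclideanSpace.single (2 : Fin 3) (1 : ℝ)⟫_ℝ)
    {e : EuclideanSpace ℝ (Fin 3)} (heΛ : e ∈ (fun q => A₁ q + t₁) '' fccStacking 1 (Real.sqrt (2 / 3)))
    (hfull : ∀ w ∈ fccSlots, e - A₁ u₁ + A₁ w ∈ X) (hv : ∃ v ∈ fccSlots, e + A₁ v ∉ X)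
    (hlow : e 2 < -12) : (ρ - 3) ^ 2 < e 0 ^ 2 + e 1 ^ 2 := by
  by_contra hrim
  push Not at hrim
  obtain ⟨v, hv, hvX⟩ := hv
  have hdd : e - A₁ u₁ + A₁ (-u₁) ∈ X := hfull _ (neg_mem_fccSlots hu₁)
  have hz := (hcell _ hdd).1
  have he2 : (e - A₁ u₁ + A₁ (-u₁)) 2 = e 2 - 2 * ⟪A₁ u₁, EuclideanSpace.single (2 : Fin 3) (1 : ℝ)⟫_ℝ := by
    rw [map_neg, PiLp.add_apply, PiLp.sub_apply, PiLp.neg_apply, apply_two_eq_inner_e₃ (A₁ u₁)]; ring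
  rw [he2] at hz
  have hs : (1 : ℝ) < Real.sqrt 2 := by
    rw [show (1 : ℝ) = Real.sqrt 1 by simp]; exact Real.sqrt_lt_sqrt (by norm_num) (by norm_num)
  obtain ⟨hl, hu⟩ := height_add_slot A₁ e hv
  have hlat := lateral_add_slot A₁ e hv (by linarith : (0 : ℝ) ≤ ρ - 3) hrim
  apply hvX
  apply hP₁X
  rw [hP₁]
  refine ⟨movedFcc_add_site_mem A₁ t₁ heΛ (mem_fcc_of_mem_fccSlots hv), by linarith, by linarith, ?_⟩
  nlinarith

/-- **High exits of the top grain are rim balls** (mirror of `lowExit_rim`): a lattice exit of grain 2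
along a steep DOWN-slot `u₂` at height `> h + 12` has lateral radius `> ρ − 3`. -/
theorem highExit₂_rim (A₂ : EuclideanSpace ℝ (Fin 3) ≃ₗᵢ[ℝ] EuclideanSpace ℝ (Fin 3)) (t₂ : EuclideanSpace ℝ (Fin 3))
    (hρ : 10 ≤ ρ) (hP₂X : P₂ ⊆ X)
    (hcell : ∀ p ∈ X, -(2 * 10) ≤ p 2 ∧ p 2 ≤ h + 2 * 10 ∧ p 0 ^ 2 + p 1 ^ 2 ≤ ρ ^ 2)
    (hP₂ : ∀ p, p ∈ P₂ ↔ (p ∈ (fun q => A₂ q + t₂) '' fccStacking 1 (Real.sqrt (2 / 3)) ∧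
      h + 10 ≤ p 2 ∧ p 2 ≤ h + 2 * 10 ∧ p 0 ^ 2 + p 1 ^ 2 ≤ ρ ^ 2))
    {u₂ : EuclideanSpace ℝ (Fin 3)} (hu₂ : u₂ ∈ fccSlots)
    (hsteep₂ : ⟪A₂ u₂, EuclideanSpace.single (2 : Fin 3) (1 : ℝ)⟫_ℝ ≤ -(Real.sqrt 2 / 2))
    {e : EuclideanSpace ℝ (Fin 3)} (heΛ : e ∈ (fun q => A₂ q + t₂) '' fccStacking 1 (Real.sqrt (2 / 3)))
    (hfull : ∀ w ∈ fccSlots, e - A₂ u₂ + A₂ w ∈ X) (hv : ∃ v ∈ fccSlots, e + A₂ v ∉ X)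
    (hhigh : h + 12 < e 2) : (ρ - 3) ^ 2 < e 0 ^ 2 + e 1 ^ 2 := by
  by_contra hrim
  push Not at hrim
  obtain ⟨v, hv, hvX⟩ := hv
  have hdd : e - A₂ u₂ + A₂ (-u₂) ∈ X := hfull _ (neg_mem_fccSlots hu₂)
  have hz := (hcell _ hdd).2.1
  have he2 : (e - A₂ u₂ + A₂ (-u₂)) 2 = e 2 - 2 * ⟪A₂ u₂, EuclideanSpace.single (2 : Fin 3) (1 : ℝ)⟫_ℝ := by
    rw [map_neg, PiLp.add_apply, PiLp.sub_apply, PiLp.neg_apply, apply_two_eq_inner_e₃ (A₂ u₂)]; ring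
  rw [he2] at hz
  have hs : (1 : ℝ) < Real.sqrt 2 := by
    rw [show (1 : ℝ) = Real.sqrt 1 by simp]; exact Real.sqrt_lt_sqrt (by norm_num) (by norm_num)
  obtain ⟨hl, hu⟩ := height_add_slot A₂ e hv
  have hlat := lateral_add_slot A₂ e hv (by linarith : (0 : ℝ) ≤ ρ - 3) hrim
  apply hvX
  apply hP₂X
  rw [hP₂]
  refine ⟨movedFcc_add_site_mem A₂ t₂ heΛ (mem_fcc_of_mem_fccSlots hv), by linarith, by linarith, ?_⟩
  nlinarith

/-- **High exits of the bottom grain are rim balls** (grains with different slot sets): an exit of grain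
1 at height `> h + 12` off the rim would put its full-shell predecessor and all twelve slot neighbours on
`Λ₂` (sealing), forcing `A₁·Λ₀ = A₂·Λ₀`. -/
theorem highExit_rim (A₁ A₂ : EuclideanSpace ℝ (Fin 3) ≃ₗᵢ[ℝ] EuclideanSpace ℝ (Fin 3))
    (t₂ : EuclideanSpace ℝ (Fin 3)) (hρ : 10 ≤ ρ) (hX : ∀ p ∈ X, ∀ q ∈ X, p ≠ q → 1 ≤ dist p q)
    (hcell : ∀ p ∈ X, -(2 * 10) ≤ p 2 ∧ p 2 ≤ h + 2 * 10 ∧ p 0 ^ 2 + p 1 ^ 2 ≤ ρ ^ 2) (hP₂X : P₂ ⊆ X)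
    (hP₂ : ∀ p, p ∈ P₂ ↔ (p ∈ (fun q => A₂ q + t₂) '' fccStacking 1 (Real.sqrt (2 / 3)) ∧
      h + 10 ≤ p 2 ∧ p 2 ≤ h + 2 * 10 ∧ p 0 ^ 2 + p 1 ^ 2 ≤ ρ ^ 2))
    (hA₁₂ : ¬ ∀ w ∈ fccSlots, A₁ w ∈ A₂ '' fccStacking 1 (Real.sqrt (2 / 3)))
    {u₁ : EuclideanSpace ℝ (Fin 3)} (hu₁ : u₁ ∈ fccSlots) {e : EuclideanSpace ℝ (Fin 3)}
    (hd : e - A₁ u₁ ∈ X) (hfull : ∀ w ∈ fccSlots, e - A₁ u₁ + A₁ w ∈ X)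
    (hhigh : h + 12 < e 2) : (ρ - 3) ^ 2 < e 0 ^ 2 + e 1 ^ 2 := by
  by_contra hrim
  push Not at hrim
  have hρ1 : (1 : ℝ) ≤ ρ := by linarith
  have hpl := pred_height_lateral A₁ e hu₁ (show (0 : ℝ) ≤ ρ - 3 by linarith) hrim
  obtain ⟨hd1, -, hdlat⟩ := hpl
  have hdlat' : (e - A₁ u₁) 0 ^ 2 + (e - A₁ u₁) 1 ^ 2 ≤ (ρ - 2) ^ 2 := by convert hdlat using 2; ring
  have hseal : ∀ q ∈ X, h + 10 ≤ q 2 → q 0 ^ 2 + q 1 ^ 2 ≤ (ρ - 1) ^ 2 → q ∈ P₂ := fun q hqX hq2 hqlat =>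
    mem_sample_of_sealed A₂ t₂ (h + 10) (h + 2 * 10) ρ hρ1 (by linarith) hX hP₂X hP₂ hqX hq2
      (hcell q hqX).2.1 hqlat
  have hdΛ : e - A₁ u₁ ∈ (fun q => A₂ q + t₂) '' fccStacking 1 (Real.sqrt (2 / 3)) :=
    ((hP₂ _).1 (hseal _ hd (by linarith) (by nlinarith))).1
  have hsite : ∀ w ∈ fccSlots, e - A₁ u₁ + A₁ w ∈ (fun q => A₂ q + t₂) '' fccStacking 1 (Real.sqrt (2 / 3)) := by
    intro w hw
    have hq2 : h + 10 ≤ (e - A₁ u₁ + A₁ w) 2 := by have := (height_add_slot A₁ (e - A₁ u₁) hw).1; linarith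
    have hqlat := lateral_add_slot A₁ (e - A₁ u₁) hw (by linarith : (0 : ℝ) ≤ ρ - 2) hdlat'
    exact ((hP₂ _).1 (hseal _ (hfull w hw) hq2 (by convert hqlat using 2; ring))).1
  have hν : A₁ u₁ ≠ 0 := by
    intro h0
    have := norm_eq_one_of_mem_fccSlots hu₁
    rw [← A₁.norm_map, h0, norm_zero] at this; exact one_ne_zero this.symm
  obtain ⟨w₁, hw₁, w₂, hw₂, w₃, hw₃, -, -, -, hind⟩ := exists_independent_slots_of_hemisphere A₁ hν
  have heq := linear_eq_of_slots_on_affine A₁ A₂ t₂ hdΛ hw₁ hw₂ hw₃ (hsite w₁ hw₁) (hsite w₂ hw₂)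
    (hsite w₃ hw₃) hind
  exact hA₁₂ fun w hw => heq ▸ ⟨w, mem_fcc_of_mem_fccSlots hw, rfl⟩

/-- **Low exits of the top grain are rim balls** (mirror of `highExit_rim`). -/
theorem lowExit₂_rim (A₁ A₂ : EuclideanSpace ℝ (Fin 3) ≃ₗᵢ[ℝ] EuclideanSpace ℝ (Fin 3))
    (t₁ : EuclideanSpace ℝ (Fin 3)) (hρ : 10 ≤ ρ) (hX : ∀ p ∈ X, ∀ q ∈ X, p ≠ q → 1 ≤ dist p q)
    (hcell : ∀ p ∈ X, -(2 * 10) ≤ p 2 ∧ p 2 ≤ h + 2 * 10 ∧ p 0 ^ 2 + p 1 ^ 2 ≤ ρ ^ 2) (hP₁X : P₁ ⊆ X)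
    (hP₁ : ∀ p, p ∈ P₁ ↔ (p ∈ (fun q => A₁ q + t₁) '' fccStacking 1 (Real.sqrt (2 / 3)) ∧
      -(2 * 10) ≤ p 2 ∧ p 2 ≤ -10 ∧ p 0 ^ 2 + p 1 ^ 2 ≤ ρ ^ 2))
    (hA₂₁ : ¬ ∀ w ∈ fccSlots, A₂ w ∈ A₁ '' fccStacking 1 (Real.sqrt (2 / 3)))
    {u₂ : EuclideanSpace ℝ (Fin 3)} (hu₂ : u₂ ∈ fccSlots) {e : EuclideanSpace ℝ (Fin 3)}
    (hd : e - A₂ u₂ ∈ X) (hfull : ∀ w ∈ fccSlots, e - A₂ u₂ + A₂ w ∈ X)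
    (hlow : e 2 < -12) : (ρ - 3) ^ 2 < e 0 ^ 2 + e 1 ^ 2 := by
  by_contra hrim
  push Not at hrim
  have hρ1 : (1 : ℝ) ≤ ρ := by linarith
  have hpl := pred_height_lateral A₂ e hu₂ (show (0 : ℝ) ≤ ρ - 3 by linarith) hrim
  obtain ⟨-, hd2, hdlat⟩ := hpl
  have hdlat' : (e - A₂ u₂) 0 ^ 2 + (e - A₂ u₂) 1 ^ 2 ≤ (ρ - 2) ^ 2 := by convert hdlat using 2; ring
  have hseal : ∀ q ∈ X, q 2 ≤ -10 → q 0 ^ 2 + q 1 ^ 2 ≤ (ρ - 1) ^ 2 → q ∈ P₁ := fun q hqX hq2 hqlat =>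
    mem_sample_of_sealed A₁ t₁ (-(2 * 10)) (-10) ρ hρ1 (by norm_num) hX hP₁X hP₁ hqX (hcell q hqX).1 hq2 hqlat
  have hdΛ : e - A₂ u₂ ∈ (fun q => A₁ q + t₁) '' fccStacking 1 (Real.sqrt (2 / 3)) :=
    ((hP₁ _).1 (hseal _ hd (by linarith) (by nlinarith))).1
  have hsite : ∀ w ∈ fccSlots, e - A₂ u₂ + A₂ w ∈ (fun q => A₁ q + t₁) '' fccStacking 1 (Real.sqrt (2 / 3)) := by
    intro w hw
    have hq2 : (e - A₂ u₂ + A₂ w) 2 ≤ -10 := by have := (height_add_slot A₂ (e - A₂ u₂) hw).2; linarith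
    have hqlat := lateral_add_slot A₂ (e - A₂ u₂) hw (by linarith : (0 : ℝ) ≤ ρ - 2) hdlat'
    exact ((hP₁ _).1 (hseal _ (hfull w hw) hq2 (by convert hqlat using 2; ring))).1
  have hν : A₂ u₂ ≠ 0 := by
    intro h0
    have := norm_eq_one_of_mem_fccSlots hu₂
    rw [← A₂.norm_map, h0, norm_zero] at this; exact one_ne_zero this.symm
  obtain ⟨w₁, hw₁, w₂, hw₂, w₃, hw₃, -, -, -, hind⟩ := exists_independent_slots_of_hemisphere A₂ hν
  have heq := linear_eq_of_slots_on_affine A₂ A₁ t₁ hdΛ hw₁ hw₂ hw₃ (hsite w₁ hw₁) (hsite w₂ hw₂)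
    (hsite w₃ hw₃) hind
  exact hA₂₁ fun w hw => heq ▸ ⟨w, mem_fcc_of_mem_fccSlots hw, rfl⟩

end Summit.Ventures.Crystal3D.Theorems

end
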